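/-
Copyright (c) 2026. All rights reserved.
Released under Apache 2.0 license as described in the file LICENSE.
Authors: abc-iut cell, wave-5 discharge seat abc-iut-w5-d067 (statements-first sub-DAG of
[AbsTopIII] Prop 5.8 (ii) + Cor 5.2 (v); companion of `plan/L4/SUBDAG-AbsTopIII-Prop58ii-Cor52v.md`).
-/
import Literature.AnabelianGeometry.AbsoluteAnabelian.MonoAnalyticLogShells
import HarnessLib

/-!
# [AbsTopIII] Prop 5.8 (ii) + Cor 5.2 (v): the junction statements of the statements-first sub-DAG

S. Mochizuki, *Topics in absolute anabelian geometry III: global reconstruction algorithms*,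
J. Math. Sci. Univ. Tokyo 22 (2015) 939–1156 [MochizukiAbsTopIII2015]; locators `p.N l.M` = pages/lines
of the author's manuscript (`paper:url-5493eb38cbb7`, 164 pp.), read on the page: Prop 5.8 (i)(ii) p. 139,
Def 5.4 (iii) p. 126, Def 3.1 (i)(ii) pp. 66–67, Cor 5.2 (v) p. 120 (proof p. 121 l. 17–20), printed proof of
Prop 5.8 p. 142 l. 10–11: "The various assertions of Proposition 5.8 are immediate from the definitions and
the references quoted in these definitions."

Prop 5.8 (ii) (p. 139 l. 25–33): "The algorithms of (i) yield a functorial [i.e., relative to `TG⊢`]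
“group-theoretic” algorithm “`Ob(TG⊢) ∋ G ↦ Γ⃗×_non(G)`” for constructing from `G` the `Γ⃗×_non`-diagram in
`𝒞^{MLF⊢}_{TS⊞}` [cf. §0] `𝒪^×_k̄(G) ↪ k̄^×(G)`, `↓`, `↓`, `k~(G) ↪ (k̄^×)^pf(G)` determined by the diagram of
Definition 5.4, (iii), hence also the log-shell `ℐ(G) ⊆ k~(G)` of `Γ⃗×_non(G)`."

## What is typed here and how (D-0068 (1) statements-first; layer policy plan/L4/ASSIGNMENTS.md §2)

The OUTPUT SIGNATURE of Prop 5.8 (i)–(iii) (`MonoAnalyticNonarch G`, incl. the four carriers of the (ii)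
diagram) and the algorithm interface `MonoAnalyticNonarchAlgorithm` are abc-iut-L4-t3's
(`MonoAnalyticLogShells.lean`); the field-side objects of Def 5.4 (iii) are abc-iut-L4-t2's / L6-d2's / t3's
(`MLFGaloisModel`, `GaloisPadicLog(Perfection)`, `LogShells`); local class field theory in the exact shape (i)
quotes is the tree's `Literature.NumberTheory.GaloisRepresentations.IsLocalReciprocityMap` (image of `k^×` =
image of the Weil subgroup, image of `𝒪_k^×` = image of the inertia subgroup in `G_k^ab`), with the Verlagerung
functoriality `verlagerung` / `recMap_transfer_fieldSubgroup` and the conjugation-equivariance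
`mlf_reciprocity_equivariant_holds` ALL IN THE TREE (sub-DAG rows L02–L04, L06, L07 of the companion table).
This file types ONLY the junction statement the construction "apply (i) at every open subgroup `J ⊆ G`, pass
to the colimit along the Verlagerung, perfect, scale by `(p*)⁻¹`, take `G`-invariants" still needs and nobody
had typed — statement only, no proofs, no `set_option` (statement-only lane):

* `Prop58ii.OpenSubgroupIsMLFGaloisType` (row L01): an open subgroup of a `G ∈ Ob(TG⊢)` is again in
  `Ob(TG⊢)` — the input licence for running (i) at the open subgroups; a `Prop` (sub-node, classical —
  Krull Galois theory + "finite extensions of MLFs are MLFs").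
* The PROVED junction rows live in the proof-only companion `MonoAnalyticLogShellsSubProofs.lean` (same seat,
  filed alongside; it does not import this file): L01 itself (`Prop58ii.openSubgroup_isMLFGaloisType` — exactly
  the type below; the `_holds` alias is appended once both files are built), L05a
  (`Prop58ii.recMapEquivWeilImage`: at the model any `IsLocalReciprocityMap θ` is an isomorphism
  `K^× ⥲ Im(W_K) ⊆ G_K^ab` carrying `𝒪_K^×` onto `Im(I_K)`, i.e. the group-theoretic `k^×(G)`, `𝒪^×_k(G)` of
  (i)/(ii) ARE `k^×`, `𝒪_k^×`), L08 (`Prop58ii.fixed_iff_mem_range_algebraMap`: under `log_k̄ : k~ ⥲ (k̄,+)`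
  the `G`-invariants `k~(G)^G` of Prop 5.8 (iii) / Def 5.4 (iii) are the base field `k`, from Mathlib's
  infinite Galois theory), and Cor 5.2 (v) row C03 (`Cor52v.equivalence_tautological`: the printed
  "equivalence `EA⊚ ⥲ An⊚[Th✠]`" is definitional once the panalocalization functor exists — objects
  `(Π, {V⊚(Π)}✠)` retain `Π`, morphisms are DEFINED as those of `EA⊚`; the contentful neighbour Rmk 5.2.1
  is a negative statement about `EA⊚ → Th✠`, deliberately untyped).

HONEST FRAMING: refereed pre-IUT anabelian geometry ([AbsTopIII] is a published prerequisite); nothing in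
this file bears on [IUTchIII] Cor. 3.12; a typed statement is not a discharged one; `OpenSubgroupIsMLFGaloisType`
is a sub-node TO BE PROVED (it is classical), never a fact to be assumed.
-/

noncomputable section

universe u

namespace Literature.AnabelianGeometry.AbsoluteAnabelian

/-! ## Row L01: open subgroups of `Ob(TG⊢)` -/

namespace Prop58ii

/-- **P58ii/L01** (sub-node of [AbsTopIII] Prop 5.8 (ii), p. 139 l. 25–27 "The algorithms of (i) yield a
functorial [i.e., relative to `TG⊢`] “group-theoretic” algorithm …"; Def 3.1 (i) p. 66: `k~ := (𝒪^×_k̄)^pf` with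
its `Π_k`-action — so (i) must be run at EVERY open subgroup `J ⊆ G` to assemble `k̄^×(G)`): an open subgroup
of a profinite group of MLF-Galois type (`Ob(TG⊢)`, Def 5.6 (i): "profinite groups isomorphic to the absolute
Galois group of an MLF") is again of MLF-Galois type — classically: an open subgroup of `G_k` is `G_{k'}` for
the finite extension `k'/k` it cuts out (Krull), and a finite extension of an MLF is an MLF. Sub-node
(PROVED as `Prop58ii.openSubgroup_isMLFGaloisType` in `MonoAnalyticLogShellsSubProofs.lean`: Mathlib `InfiniteGalois` + the tree's `algEquivContinuousMulEquivAbsoluteGaloisGroup` + "finite over finite is finite").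
[cite: MochizukiAbsTopIII2015, Prop 5.8 (ii) p. 139] -/
def OpenSubgroupIsMLFGaloisType : Prop :=
  ∀ (G : ProfiniteGrp.{u}), IsMLFGaloisType G →
    ∀ U : OpenSubgroup G, IsMLFGaloisType (ProfiniteGrp.ofClosedSubgroup ⟨U.toSubgroup, U.isClosed⟩)

end Prop58ii

end Literature.AnabelianGeometry.AbsoluteAnabelian

end
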